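import Mathlib
import Summits.Ventures.HodgeRepro.LitRankYanai2

/-!
# LitRankYanai3 — the two cases of Yanai's proof (main and exceptional)

Blind cell `pub-hodge-repro`, seat lit-2. Part 3 of 4 of the former single file `LitRankYanai.lean` (split at the ≤ 400-line rule, gen 4; text of every declaration unchanged). Imports `LitRankYanai2` (and through it the rest of the chain).
-/

open Finset
open scoped Pointwise

namespace HodgeRepro.Lit2

/-! ## §4–5  The two cases of Yanai's proof -/

namespace CMTriple

variable {G : Type} [Group G] [Fintype G] [DecidableEq G] (T : CMTriple G)

/-- Yanai's exceptional case "`S = ⟨g₀⟩`": `g₀` stabilises `S̃ ∩ ⟨ρ g₀⟩`. -/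
def Exc (g₀ : G) : Prop := ∀ c ∈ Subgroup.zpowers (T.ρ * g₀), (g₀ * c ∈ T.S ↔ c ∈ T.S)

omit [Fintype G] in
/-- The exceptional condition for the right translate `S̃ g`, unfolded. -/
theorem exc_rightTranslate_iff (g₀ g : G) :
    (T.rightTranslate g).Exc g₀ ↔ ∀ c ∈ Subgroup.zpowers (T.ρ * g₀),
      (g₀ * c * g⁻¹ ∈ T.S ↔ c * g⁻¹ ∈ T.S) := by
  unfold Exc
  simp only [rightTranslate_ρ, rightTranslate_S, T.mem_image_mul_right_iff]

section Transversal

variable {g₀ : G} (hg : orderOf g₀ = T.dim) (hgH : g₀ ∉ T.H) (hd : T.dim.Prime) (hd2 : T.dim ≠ 2)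

omit [Fintype G] [DecidableEq G] in
/-- `g₀ = ρ⁻¹ (ρ g₀) ∈ ⟨ρ g₀⟩`. -/
theorem g₀_mem_zpowers (hg : orderOf g₀ = T.dim) (hd : T.dim.Prime) (hd2 : T.dim ≠ 2) :
    g₀ ∈ Subgroup.zpowers (T.ρ * g₀) := by
  have := Subgroup.mul_mem _ (Subgroup.inv_mem _ (T.ρ_mem_zpowers hg hd hd2))
    (Subgroup.mem_zpowers (T.ρ * g₀))
  rwa [inv_mul_cancel_left] at this

omit [Fintype G] in
/-- The restricted type on `C = ⟨ρ g₀⟩` and the element `γ = g₀ ∈ C`: `Exc` says `γ S̃_C = S̃_C`. -/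
theorem exc_iff_smul_eq (C : Subgroup G) (hC : C = Subgroup.zpowers (T.ρ * g₀)) (hρC : T.ρ ∈ C)
    (hg₀C : g₀ ∈ C) [Fintype C] :
    T.Exc g₀ ↔ ((⟨g₀, hg₀C⟩ : C) • (T.restrict C hρC).S = (T.restrict C hρC).S) := by
  constructor
  · intro hexc
    ext x
    rw [← Finset.inv_smul_mem_iff, mem_restrict_S, mem_restrict_S]
    have := hexc ((⟨g₀, hg₀C⟩ : C)⁻¹ * x : C) (hC ▸ ((⟨g₀, hg₀C⟩ : C)⁻¹ * x).2)
    simp only [Subgroup.coe_mul, Subgroup.coe_inv, mul_inv_cancel_left] at this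
    rw [smul_eq_mul]
    exact this.symm
  · intro hst c hc
    have hc' : c ∈ C := hC ▸ hc
    have key := Finset.smul_mem_smul_finset_iff (⟨g₀, hg₀C⟩ : C) (b := (⟨c, hc'⟩ : C))
      (s := (T.restrict C hρC).S)
    rw [hst, mem_restrict_S, mem_restrict_S] at key
    simpa using key

end Transversal

/-! ### The main case: `g₀` does not stabilise `S̃ ∩ ⟨ρ g₀⟩` -/

/-- **Yanai's theorem, non-exceptional case** (`S ≠ ⟨g₀⟩, ⟨g₀⟩ρ` in Yanai's words): the restricted
type on the cyclic transversal `⟨ρ g₀⟩` is simple, hence nondegenerate by Yanai's Lemma; Tankeev's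
inequality and the upper bound `rank ≤ d + 1` then force `rank = d + 1`. -/
theorem isNondegenerate_of_not_exc (hK : Kubota_rank_abelian_charFormula) (hd : T.dim.Prime)
    (hd2 : T.dim ≠ 2) {g₀ : G} (hg : orderOf g₀ = T.dim) (hgH : g₀ ∉ T.H) (hne : ¬ T.Exc g₀) :
    T.IsNondegenerate := by
  classical
  set C := Subgroup.zpowers (T.ρ * g₀) with hCdef
  have hρC : T.ρ ∈ C := T.ρ_mem_zpowers hg hd hd2
  have hCH : C ⊓ T.H = ⊥ := T.zpowers_inf_H_eq_bot hg hgH hd hd2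
  have hcardC : Nat.card C = T.H.index := by
    rw [hCdef, Nat.card_zpowers, T.orderOf_ρ_mul hg hd hd2, T.index_eq_two_mul_dim]
  have hHC := T.exists_mul_eq_of_inf_eq_bot C hCH hcardC
  haveI : Fintype C := Fintype.ofFinite C
  have hcardC' : Fintype.card C = 2 * T.dim := by
    rw [← Nat.card_eq_fintype_card, hcardC, T.index_eq_two_mul_dim]
  set U := T.restrict C hρC with hU
  let γ : C := ⟨g₀, T.g₀_mem_zpowers hg hd hd2⟩
  have hγ : orderOf γ = T.dim := by rw [Subgroup.orderOf_mk, hg]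
  have hgen : ∀ c : C, c ∈ Subgroup.zpowers (U.ρ * γ) := by
    intro c
    obtain ⟨x, hx⟩ := c
    obtain ⟨k, hk⟩ := hx
    refine ⟨k, Subtype.ext ?_⟩
    show (T.ρ * g₀) ^ k = x
    exact hk
  have hUsimple : U.IsSimple :=
    U.isSimple_of_not_smul_eq rfl hd hd2 hγ hgen
      (by rwa [← T.exc_iff_smul_eq C hCdef hρC (T.g₀_mem_zpowers hg hd hd2)])
  have hUnondeg : U.IsNondegenerate :=
    Yanai1985_lemma_cyclic_nondegenerate_of_charFormula hK T.dim hd hd2 C hcardC' U rfl hUsimple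
  have hUdim : U.dim = T.dim := by
    unfold dim
    rw [show U.H = ⊥ from rfl, Subgroup.index_bot, hcardC, T.index_eq_two_mul_dim]
  have h1 : U.rank ≤ T.rank := T.rank_restrict_le C hρC hHC
  have h2 : T.rank ≤ T.dim + 1 := T.rank_le_dim_add_one
  unfold IsNondegenerate at hUnondeg ⊢
  omega

/-! ### The exceptional case `S = ⟨g₀⟩`, `⟨g₀⟩ρ` -/

omit [Fintype G] in
/-- `ρ S̃` is `H`-saturated on the left (`ρ` central). -/
theorem smul_ρ_S_saturated : ∀ h ∈ T.H, ∀ x ∈ T.ρ • T.S, h * x ∈ T.ρ • T.S := by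
  intro h hh x hx
  rw [Finset.mem_smul_finset] at hx ⊢
  obtain ⟨s, hs, rfl⟩ := hx
  refine ⟨h * s, T.H_mul_mem h hh s hs, ?_⟩
  simp only [smul_eq_mul]
  rw [← mul_assoc, T.ρ_comm h, mul_assoc]

/-- **Yanai's theorem, exceptional case**: if `g₀` stabilises `S̃ ∩ ⟨ρ g₀⟩`, replace `S̃` by a Galois
conjugate `S̃ g ∉ {S̃, S̃ ρ}` (it exists since `rank ≥ 3`), which is non-exceptional and has the same
rank (Yanai Prop. A (b)). -/
theorem isNondegenerate_of_exc (hK : Kubota_rank_abelian_charFormula) (hd : T.dim.Prime)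
    (hd2 : T.dim ≠ 2) (hs : T.IsSimple) {g₀ : G} (hg : orderOf g₀ = T.dim) (hgH : g₀ ∉ T.H)
    (hexc : T.Exc g₀) : T.IsNondegenerate := by
  classical
  -- a conjugate `S̃ g` different from `S̃` and `S̃ᶜ`
  have hd1 : 2 ≤ T.dim := hd.two_le
  have hrank3 := T.three_le_rank_of_isSimple hs hd1
  by_cases hall : ∀ g : G, T.S.image (· * g) = T.S ∨ T.S.image (· * g) = T.Sᶜ
  · exfalso
    -- all right translates lie in `span {𝟙_S̃, 𝟙_S̃ᶜ}`, so `rank ≤ 2`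
    have hle : Submodule.span ℚ (Set.range fun g : G => indFun (T.S.image (· * g))) ≤
        Submodule.span ℚ (({indFun T.S, indFun T.Sᶜ} : Finset (G → ℚ)) : Set (G → ℚ)) := by
      rw [Submodule.span_le]
      rintro _ ⟨g, rfl⟩
      apply Submodule.subset_span
      rcases hall g with h | h <;> simp [h]
    have := T.rank_eq_finrank_span_rightTranslates
    have h2 : Module.finrank ℚ (Submodule.span ℚ
        (({indFun T.S, indFun T.Sᶜ} : Finset (G → ℚ)) : Set (G → ℚ))) ≤ 2 :=
      (finrank_span_finset_le_card _).trans (Finset.card_le_two)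
    have := Submodule.finrank_mono hle
    omega
  · obtain ⟨g, hg12⟩ := not_forall.mp hall
    have hg1 : T.S.image (· * g) ≠ T.S := fun h => hg12 (Or.inl h)
    have hg2 : T.S.image (· * g) ≠ T.Sᶜ := fun h => hg12 (Or.inr h)
    set T' := T.rightTranslate g with hT'
    have hs' : T'.IsSimple := T.isSimple_rightTranslate g hs
    -- `T'` is not exceptional
    have hne' : ¬ T'.Exc g₀ := by
      intro hexc'
      set C := Subgroup.zpowers (T.ρ * g₀) with hCdef
      have hρC : T.ρ ∈ C := T.ρ_mem_zpowers hg hd hd2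
      have hCH : C ⊓ T.H = ⊥ := T.zpowers_inf_H_eq_bot hg hgH hd hd2
      have hcardC : Nat.card C = T.H.index := by
        rw [hCdef, Nat.card_zpowers, T.orderOf_ρ_mul hg hd hd2, T.index_eq_two_mul_dim]
      have hHC := T.exists_mul_eq_of_inf_eq_bot C hCH hcardC
      haveI : Fintype C := Fintype.ofFinite C
      have hcardC' : Fintype.card C = 2 * T.dim := by
        rw [← Nat.card_eq_fintype_card, hcardC, T.index_eq_two_mul_dim]
      let γ : C := ⟨g₀, T.g₀_mem_zpowers hg hd hd2⟩
      have hγ : orderOf γ = T.dim := by rw [Subgroup.orderOf_mk, hg]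
      set U := T.restrict C hρC with hU
      set U' := T'.restrict C hρC with hU'
      have hg₀C : g₀ ∈ C := T.g₀_mem_zpowers hg hd hd2
      have hst : γ • U.S = U.S := (T.exc_iff_smul_eq C hCdef hρC hg₀C).mp hexc
      have hst' : γ • U'.S = U'.S := (T'.exc_iff_smul_eq C hCdef hρC hg₀C).mp hexc'
      have hdich := U.S_eq_zpowers_or_of_smul_eq hγ hcardC' hst
      have hdich' := U'.S_eq_zpowers_or_of_smul_eq hγ hcardC' hst'
      -- membership dictionary
      have hmemU : ∀ c : C, c ∈ U.S ↔ (c : G) ∈ T.S := fun c => T.mem_restrict_S C hρC c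
      have hmemU' : ∀ c : C, c ∈ U'.S ↔ (c : G) ∈ T.S.image (· * g) := fun c =>
        T'.mem_restrict_S C hρC c
      have hρU : U.ρ = ⟨T.ρ, hρC⟩ := rfl
      have hρeq : U'.ρ = U.ρ := rfl
      have hρρ : U.ρ * U.ρ = 1 := U.ρ_mul_self
      have hsat : ∀ h ∈ T.H, ∀ x ∈ T.S.image (· * g), h * x ∈ T.S.image (· * g) :=
        T'.H_mul_mem
      -- case analysis on the two dichotomies
      have hcase : U'.S = U.S ∨ U'.S = U.ρ • U.S := by
        rcases hdich with h1 | h1 <;> rcases hdich' with h2 | h2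
        · left; rw [h1, h2]
        · right; rw [h2, h1, hρeq]
        · right; rw [h2, h1, smul_smul, hρρ, one_smul]
        · left; rw [h1, h2, hρeq]
      rcases hcase with hcase | hcase
      · apply hg1
        apply T.eq_of_inter_eq C hHC hsat T.H_mul_mem
        intro c hc
        have := congrArg (fun F => (⟨c, hc⟩ : C) ∈ F) hcase
        simp only [eq_iff_iff] at this
        rw [hmemU', hmemU] at this
        exact this
      · apply hg2
        rw [← T.smul_S_eq_compl]
        apply T.eq_of_inter_eq C hHC hsat T.smul_ρ_S_saturated
        intro c hc
        have := congrArg (fun F => (⟨c, hc⟩ : C) ∈ F) hcase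
        simp only [eq_iff_iff] at this
        rw [hmemU', ← Finset.inv_smul_mem_iff, hmemU] at this
        rw [this, Finset.mem_smul_finset]
        constructor
        · intro hmem
          refine ⟨T.ρ⁻¹ * c, ?_, by simp⟩
          simpa [hρU] using hmem
        · rintro ⟨y, hy, rfl⟩
          simpa [hρU] using hy
    have hnd' : T'.IsNondegenerate := T'.isNondegenerate_of_not_exc hK hd hd2 hg hgH hne'
    unfold IsNondegenerate at hnd' ⊢
    rw [hT', T.rank_rightTranslate, T.dim_rightTranslate] at hnd'
    exact hnd'

/-- **Yanai's theorem in the faithful case** (`normalCore H = ⊥`), `d` an odd prime. -/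
theorem isNondegenerate_of_normalCore_eq_bot (hK : Kubota_rank_abelian_charFormula)
    (hcore : T.H.normalCore = ⊥) (hd : T.dim.Prime) (hd2 : T.dim ≠ 2) (hs : T.IsSimple) :
    T.IsNondegenerate := by
  obtain ⟨g₀, hg, hgH⟩ := T.exists_orderOf_eq_dim_notMem_H hcore hd
  by_cases hexc : T.Exc g₀
  · exact T.isNondegenerate_of_exc hK hd hd2 hs hg hgH hexc
  · exact T.isNondegenerate_of_not_exc hK hd hd2 hg hgH hexc

end CMTriple

end HodgeRepro.Lit2
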